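import Mathlib

/-!
# Crux-triage (round 1, triager 2) — ShadowBirkhoff: the two planar transfer targets as TYPED

Verbatim copies (namespaced here) of the transfer targets of the two planar cards, and their
cheap fate:

* `DominoShadow` (card `polytrope-kr-planar-dimers`, Sketch-ideator2.lean) quantifies over ALL
  board sizes `m ≥ m₀`; an odd board has no domino tiling (a fixed-point-free involution of a set
  of odd size does not exist), so the point set is empty and the claimed strict inequality fails:
  `¬ DominoShadow` (`not_dominoShadow`).  Fix: boards `Fin (2m) × Fin (2m)`.
* `GridDimerShadow` (card `planar-transport-transfer`, SketchIdeator3.lean) never asks the `m`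
  designated optima `ρs i` to be distinct, so ONE strict optimum repeated `m` times witnesses it for
  every `m`: `GridDimerShadow` holds trivially (`gridDimerShadow_trivial`), hence the card's "first
  lemma" `GridDimerShadow → ShadowBirkhoff` is the crux itself.  Fix: add
  `∀ i j, (∀ u, IsBlack u → ρs i u = ρs j u) → i = j`.
-/

set_option linter.dupNamespace false

namespace Summit.ValiantsHypothesis.ValiantsHypothesis.Cruxes.ShadowBirkhoff.TriageR1K2

open scoped BigOperators

/-! ## Card polytrope-kr-planar-dimers: `DominoShadow` is false at odd board sizes -/

/-- Grid adjacency on `Fin m × Fin m` (verbatim from Sketch-ideator2.lean). -/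
def IsGridAdjacent {m : ℕ} (v w : Fin m × Fin m) : Prop :=
  (((v.1 : ℕ) + 1 = w.1 ∧ v.2 = w.2) ∨ ((w.1 : ℕ) + 1 = v.1 ∧ v.2 = w.2) ∨
    (v.1 = w.1 ∧ (v.2 : ℕ) + 1 = w.2) ∨ (v.1 = w.1 ∧ (w.2 : ℕ) + 1 = v.2))

/-- Domino tilings of the `m × m` square (verbatim from Sketch-ideator2.lean). -/
def dominoPoints (m : ℕ) : Set ((Fin m × Fin m) × (Fin m × Fin m) → ℝ) :=
  {x | ∃ f : Fin m × Fin m → Fin m × Fin m,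
    (∀ v, f (f v) = v ∧ f v ≠ v ∧ IsGridAdjacent v (f v)) ∧ x = fun e => if f e.1 = e.2 then 1 else 0}

/-- Transfer target of card polytrope-kr-planar-dimers (verbatim from Sketch-ideator2.lean). -/
def DominoShadow : Prop :=
  ∀ c : ℕ, ∃ m₀ : ℕ, ∀ m ≥ m₀,
    ∃ L : (((Fin m × Fin m) × (Fin m × Fin m)) → ℝ) →ₗ[ℝ] (Fin 2 → ℝ),
      2 ^ ((Nat.log 2 m + c) ^ c) < (Set.extremePoints ℝ (convexHull ℝ (L '' dominoPoints m))).ncard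

/-- A fixed-point-free involution forces an even ground set: odd boards have no tilings. -/
theorem dominoPoints_eq_empty_of_odd {m : ℕ} (hm : ¬ 2 ∣ m) : dominoPoints m = ∅ := by
  ext x
  simp only [dominoPoints, Set.mem_setOf_eq, Set.mem_empty_iff_false, iff_false, not_exists,
    not_and]
  intro f hf _
  have hinv : Function.Involutive f := fun v => (hf v).1
  set σ : Equiv.Perm (Fin m × Fin m) := hinv.toPerm f with hσ
  have hσ2 : σ ^ 2 ^ 1 = 1 := by
    rw [pow_one, sq]
    refine Equiv.ext fun v => ?_
    simp [σ, Equiv.Perm.mul_apply, hinv v]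
  have hcard : ¬ 2 ∣ Fintype.card (Fin m × Fin m) := by
    rw [Fintype.card_prod, Fintype.card_fin]
    intro h
    rcases (Nat.Prime.dvd_mul Nat.prime_two).1 h with h | h <;> exact hm h
  haveI : Fact (Nat.Prime 2) := ⟨Nat.prime_two⟩
  obtain ⟨a, ha⟩ := Equiv.Perm.exists_fixed_point_of_prime hcard hσ2
  exact (hf a).2.1 (by simpa [σ] using ha)

/-- `DominoShadow` as typed is false (it fails at every odd `m ≥ m₀`). -/
theorem not_dominoShadow : ¬ DominoShadow := by
  intro h
  obtain ⟨m₀, hm₀⟩ := h 0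
  obtain ⟨L, hL⟩ := hm₀ (2 * m₀ + 1) (by omega)
  have hodd : ¬ 2 ∣ 2 * m₀ + 1 := by omega
  rw [dominoPoints_eq_empty_of_odd hodd, Set.image_empty, convexHull_empty, extremePoints_empty,
    Set.ncard_empty] at hL
  exact Nat.not_lt_zero _ hL

/-! ## Card planar-transport-transfer: `GridDimerShadow` is trivially true -/

/-- Grid adjacency (verbatim from SketchIdeator3.lean). -/
def GridAdj {m : ℕ} (u v : Fin m × Fin m) : Prop :=
  (u.1 = v.1 ∧ ((u.2 : ℕ) + 1 = v.2 ∨ (v.2 : ℕ) + 1 = u.2)) ∨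
  (u.2 = v.2 ∧ ((u.1 : ℕ) + 1 = v.1 ∨ (v.1 : ℕ) + 1 = u.1))

/-- Black cells (verbatim from SketchIdeator3.lean). -/
def IsBlack {m : ℕ} (u : Fin m × Fin m) : Prop := ((u.1 : ℕ) + (u.2 : ℕ)) % 2 = 0

open Classical in
/-- Black-charged affine cost (verbatim from SketchIdeator3.lean). -/
noncomputable def blackCost {m : ℕ} (w : Fin m × Fin m → Fin m × Fin m → ℝ × ℝ)
    (ρ : Equiv.Perm (Fin m × Fin m)) (t : ℝ) : ℝ :=
  ∑ u, if IsBlack u then (w u (ρ u)).1 + t * (w u (ρ u)).2 else 0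

/-- Transfer target of card planar-transport-transfer (verbatim from SketchIdeator3.lean). -/
def GridDimerShadow : Prop :=
  ∀ c : ℕ, ∃ k₀ : ℕ, ∀ k ≥ k₀,
    ∃ w : Fin (2 * k) × Fin (2 * k) → Fin (2 * k) × Fin (2 * k) → ℝ × ℝ, ∃ m : ℕ,
      2 ^ ((Nat.log 2 (2 * k) + c) ^ c) < m ∧
      ∃ ρs : Fin m → Equiv.Perm (Fin (2 * k) × Fin (2 * k)), ∃ ts : Fin m → ℝ,
        (∀ i u, GridAdj u (ρs i u)) ∧
        ∀ i (ρ : Equiv.Perm (Fin (2 * k) × Fin (2 * k))), (∀ u, GridAdj u (ρ u)) →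
          (∃ u, IsBlack u ∧ ρ u ≠ ρs i u) → blackCost w (ρs i) (ts i) < blackCost w ρ (ts i)

/-- Pair column `2a` with column `2a + 1`. -/
def pairCol (k : ℕ) (j : Fin (2 * k)) : Fin (2 * k) :=
  ⟨if j.val % 2 = 0 then j.val + 1 else j.val - 1, by
    rcases j with ⟨j, hj⟩
    dsimp only
    split_ifs with h <;> omega⟩

theorem pairCol_val (k : ℕ) (j : Fin (2 * k)) :
    (pairCol k j).val = if j.val % 2 = 0 then j.val + 1 else j.val - 1 := rfl

theorem pairCol_invol (k : ℕ) : Function.Involutive (pairCol k) := by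
  intro j
  apply Fin.ext
  rw [pairCol_val, pairCol_val]
  rcases j with ⟨j, hj⟩
  dsimp only
  split_ifs with h1 h2 h2 <;> omega

/-- The horizontal-domino involution of the `2k × 2k` board: `(i, j) ↦ (i, j xor 1)`. -/
def rho0 (k : ℕ) : Equiv.Perm (Fin (2 * k) × Fin (2 * k)) :=
  Equiv.prodCongr (Equiv.refl _) (Function.Involutive.toPerm (pairCol k) (pairCol_invol k))

theorem rho0_apply (k : ℕ) (u : Fin (2 * k) × Fin (2 * k)) : rho0 k u = (u.1, pairCol k u.2) := by
  rcases u with ⟨i, j⟩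
  rfl

theorem gridAdj_rho0 (k : ℕ) (u : Fin (2 * k) × Fin (2 * k)) : GridAdj u (rho0 k u) := by
  rw [rho0_apply]
  left
  refine ⟨rfl, ?_⟩
  show (u.2 : ℕ) + 1 = (pairCol k u.2).val ∨ (pairCol k u.2).val + 1 = u.2
  rw [pairCol_val]
  rcases u with ⟨i, ⟨j, hj⟩⟩
  dsimp only
  split_ifs with h <;> omega

/-- Weights: `0` on the designated cells `(u, rho0 u)`, `1` elsewhere; no parametric part. -/
noncomputable def w0 (k : ℕ) (u v : Fin (2 * k) × Fin (2 * k)) : ℝ × ℝ :=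
  (if v = rho0 k u then 0 else 1, 0)

theorem blackCost_rho0 (k : ℕ) (t : ℝ) : blackCost (w0 k) (rho0 k) t = 0 := by
  unfold blackCost
  refine Finset.sum_eq_zero fun u _ => ?_
  split_ifs with h
  · simp [w0]
  · rfl

theorem blackCost_pos (k : ℕ) (t : ℝ) (ρ : Equiv.Perm (Fin (2 * k) × Fin (2 * k)))
    (h : ∃ u, IsBlack u ∧ ρ u ≠ rho0 k u) : 0 < blackCost (w0 k) ρ t := by
  obtain ⟨u₀, hb, hne⟩ := h
  unfold blackCost
  apply Finset.sum_pos'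
  · intro u _
    split_ifs with h1
    · simp only [w0, mul_zero, add_zero]
      split_ifs <;> norm_num
    · exact le_rfl
  · refine ⟨u₀, Finset.mem_univ _, ?_⟩
    rw [if_pos hb]
    simp [w0, hne]

/-- `GridDimerShadow` as typed holds trivially: repeat one strict optimum `m` times. -/
theorem gridDimerShadow_trivial : GridDimerShadow := by
  intro c
  refine ⟨0, fun k _ => ⟨w0 k, 2 ^ ((Nat.log 2 (2 * k) + c) ^ c) + 1, Nat.lt_succ_self _,
    fun _ => rho0 k, fun _ => 0, fun _ u => gridAdj_rho0 k u, ?_⟩⟩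
  intro i ρ _ hρ
  rw [blackCost_rho0]
  exact blackCost_pos k 0 ρ hρ

end Summit.ValiantsHypothesis.ValiantsHypothesis.Cruxes.ShadowBirkhoff.TriageR1K2
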